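import Summits.NavierStokesRegularity.NavierStokesRegularity.Theorems.PeepholeVorticityDoorCoreDefs
import Literature.Analysis.FluidPDE.NSVorticityBKMProofs
import Literature.Analysis.FluidPDE.NSVorticityOfSmoothRepresentative

/-!
# PeepholeVorticityDoorCylinder — door S29 «PeepholeVorticityDoor», FILE 2: Stub D `CylinderPackageS29`
# (the Carleman cylinder fits at lateness `t1S29pkg`; ns-s29-p2 g2, DIRECTOR-NS #137/#138; CARVE 691b0f1a3d97ebcd §2 D1/D2/D3)

At the slice `t̄ ∈ (−T₁, 0)`, `T₁ = t1S29pkg c₁ |y₀| R r_T = min(1/2, (min c₁ 1)²/(4(|y₀|+3R+r_T+4)²))`, put `ℓ = √(−t̄)`,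
`x₀ = ℓ y₀`, `T' = T_c ℓ²` (`T_c = tcS29 C_u K = min(1, 1/K, 1/C_u²)`), Carleman radius `r_T ℓ`, lag `τ = T_c/8000`.  The ten
conjuncts of `CylinderPackageS29`, each elementary:
* D1 geometry + (5.5): (i) `−1 < t̄ − T'` (`ℓ² < 1/2`); (ii) `B̄(x₀, r_Tℓ+ℓ) ⊆ B(0, ½)` (`ℓ(|y₀|+r_T+1) < ½`); (iii) `|u| ≤ T'^{−1/2}`,
  `|∇u| ≤ T'⁻¹` on `[t̄−T', t̄] × B̄(x₀, r_Tℓ)` from (1.15) (`C_u ≤ T_c^{−1/2}`), the gradient bound (`K ≤ T_c⁻¹`), `√(−t) ≥ ℓ` and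
  `ℓ(|y₀|+r_T+2) ≤ c₁` (the cylinder sits inside the gradient region);
* D2 continuity: (iv), (v), (x) joint continuity of `curl u` and `∇ curl u` on compact sub-cylinders of the OPEN region
  `(−1,0) × B(0,1)`, from `smooth_velocity` (`continuousOn_fderiv_slice_of_isOpen` and its `C^∞` upgrade proved here);
* D3 bounds + core geometry: (vi) `|ω| ≤ 4‖∇u‖ ≤ 6K/ℓ²`, `‖∇ω‖ ≤ ‖curlCLM‖‖D²u‖ ≤ 6K₂/ℓ³` (`norm_curl_le_four_mul`,
  `norm_fderiv_curl_le_of_contDiffOn`, `norm_curlCLM_le_four`); (vii) the peephole hypothesis restated for `U 0`;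
  (viii) `B(0,3Rℓ) ⊆ B(x₀, r_Tℓ/2)` from `2(|y₀|+3R)+2 ≤ r_T`; (ix) the Gaussian weight exponent `‖x−x₀‖²/(4s) ≤ (|y₀|+3R)²/(4τ)`
  for `s ≥ τℓ²` on `B(0,3Rℓ)`.

Closes `theorem cylinderPackageS29_holds : CylinderPackageS29` — one of the six hypotheses of `peepholeToCore_of_stubs`.
The lateness `T₁ ≤ 1/2` honours S29 ERRATUM 1 E1 (`Negative/ExplicitFalseAsTyped.lean`): the whole cylinder stays in `(−1, 0)`.
WHAT THIS IS NOT: not NS regularity; not `NoTypeII` (stmt-0056 OPEN); geometric bookkeeping for a HYPOTHETICAL-blow-up door.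
-/

noncomputable section

set_option linter.dupNamespace false

namespace Summit.NavierStokesRegularity.NavierStokesRegularity.Theorems.PeepholeVorticityDoor

open MeasureTheory Set Function Filter Topology TopologicalSpace Metric
open scoped RealInnerProductSpace NNReal Topology ContDiff
open Literature.Analysis Literature.Analysis.FluidPDE

/-! ## §0 Calculus on the open region -/

/-- the open interior `(−1, 0) × B(0, 1)` of the door's region is open. -/
theorem isOpen_regionS29 :
    IsOpen (Ioo (-1 : ℝ) 0 ×ˢ ball (0 : EuclideanSpace ℝ (Fin 3)) 1) :=
  isOpen_Ioo.prod isOpen_ball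

/-- the open interior is contained in the door's region `[−1, 0) × B(0, 1)`. -/
theorem regionS29_interior_subset :
    Ioo (-1 : ℝ) 0 ×ˢ ball (0 : EuclideanSpace ℝ (Fin 3)) 1 ⊆ Ico (-1 : ℝ) 0 ×ˢ ball (0 : EuclideanSpace ℝ (Fin 3)) 1 :=
  prod_mono Ioo_subset_Ico_self Subset.rfl

/-- On an open region, the slice derivatives `(t, x) ↦ Dₓ(w t)(x)` of a jointly `C^∞` field form a jointly `C^∞` field
(region twin of `IsSmoothSpaceTimeOn.fderiv_slice`; `C^∞` upgrade of `continuousOn_fderiv_slice_of_isOpen`). -/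
theorem contDiffOn_fderiv_slice_of_isOpen_region {E F : Type*} [NormedAddCommGroup E] [NormedSpace ℝ E]
    [NormedAddCommGroup F] [NormedSpace ℝ F] {O : Set (ℝ × E)} {w : ℝ → E → F}
    (hO : IsOpen O) (hw : ContDiffOn ℝ ∞ (uncurry w) O) :
    ContDiffOn ℝ ∞ (uncurry fun t x => fderiv ℝ (w t) x) O := by
  have hD : ContDiffOn ℝ ∞ (fderiv ℝ (uncurry w)) O := hw.fderiv_of_isOpen hO (by simp)
  have h1 : ContDiffOn ℝ ∞
      (fun z : ℝ × E => (fderiv ℝ (uncurry w) z).comp (ContinuousLinearMap.inr ℝ ℝ E)) O :=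
    hD.clm_comp contDiffOn_const
  refine h1.congr ?_
  rintro ⟨t, x⟩ hz
  have hd : HasFDerivAt (uncurry w) (fderiv ℝ (uncurry w) (t, x)) (t, x) :=
    ((hw.contDiffAt (hO.mem_nhds hz)).differentiableAt (by simp)).hasFDerivAt
  exact (hd.comp x (hasFDerivAt_prodMk_right t x)).fderiv

/-- slices of a jointly smooth field on an open region are differentiable at interior points. -/
theorem differentiableAt_slice_of_contDiffOn_region {E F : Type*} [NormedAddCommGroup E] [NormedSpace ℝ E]
    [NormedAddCommGroup F] [NormedSpace ℝ F] {O : Set (ℝ × E)} {w : ℝ → E → F}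
    (hO : IsOpen O) (hw : ContDiffOn ℝ ∞ (uncurry w) O) {t : ℝ} {x : E} (hz : (t, x) ∈ O) :
    DifferentiableAt ℝ (w t) x := by
  have hd : HasFDerivAt (uncurry w) (fderiv ℝ (uncurry w) (t, x)) (t, x) :=
    ((hw.contDiffAt (hO.mem_nhds hz)).differentiableAt (by simp)).hasFDerivAt
  exact (hd.comp x (hasFDerivAt_prodMk_right t x)).differentiableAt

section Solution

variable {u : ℝ → EuclideanSpace ℝ (Fin 3) → EuclideanSpace ℝ (Fin 3)} {p : ℝ → EuclideanSpace ℝ (Fin 3) → ℝ}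

/-- the velocity is jointly smooth on the open interior. -/
theorem smooth_velocity_interior
    (hsol : IsClassicalNSSolutionOnRegion (Ico (-1 : ℝ) 0 ×ˢ ball (0 : EuclideanSpace ℝ (Fin 3)) 1) 1 0 u p) :
    ContDiffOn ℝ ∞ (uncurry u) (Ioo (-1 : ℝ) 0 ×ˢ ball (0 : EuclideanSpace ℝ (Fin 3)) 1) :=
  hsol.smooth_velocity.mono regionS29_interior_subset

/-- each time slice of the velocity is smooth on the unit ball. -/
theorem contDiffOn_velocity_slice
    (hsol : IsClassicalNSSolutionOnRegion (Ico (-1 : ℝ) 0 ×ˢ ball (0 : EuclideanSpace ℝ (Fin 3)) 1) 1 0 u p)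
    {t : ℝ} (ht : t ∈ Ico (-1 : ℝ) 0) :
    ContDiffOn ℝ ∞ (u t) (ball (0 : EuclideanSpace ℝ (Fin 3)) 1) :=
  (hsol.contDiffOn_velocity t).mono fun x hx => show (t, x) ∈ _ from mk_mem_prod ht hx

/-- joint continuity of `(t, x) ↦ ∇u(t, x)` on the open interior. -/
theorem continuousOn_fderiv_velocity
    (hsol : IsClassicalNSSolutionOnRegion (Ico (-1 : ℝ) 0 ×ˢ ball (0 : EuclideanSpace ℝ (Fin 3)) 1) 1 0 u p) :
    ContinuousOn (fun z : ℝ × EuclideanSpace ℝ (Fin 3) => fderiv ℝ (u z.1) z.2)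
      (Ioo (-1 : ℝ) 0 ×ˢ ball (0 : EuclideanSpace ℝ (Fin 3)) 1) :=
  continuousOn_fderiv_slice_of_isOpen isOpen_regionS29 (smooth_velocity_interior hsol) (by simp)

/-- joint continuity of `(t, x) ↦ D(∇u(t, ·))(x)` (second spatial derivative) on the open interior. -/
theorem continuousOn_fderiv_fderiv_velocity
    (hsol : IsClassicalNSSolutionOnRegion (Ico (-1 : ℝ) 0 ×ˢ ball (0 : EuclideanSpace ℝ (Fin 3)) 1) 1 0 u p) :
    ContinuousOn (fun z : ℝ × EuclideanSpace ℝ (Fin 3) => fderiv ℝ (fun x => fderiv ℝ (u z.1) x) z.2)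
      (Ioo (-1 : ℝ) 0 ×ˢ ball (0 : EuclideanSpace ℝ (Fin 3)) 1) :=
  continuousOn_fderiv_slice_of_isOpen isOpen_regionS29
    (contDiffOn_fderiv_slice_of_isOpen_region isOpen_regionS29 (smooth_velocity_interior hsol)) (by simp)

/-- joint continuity of the vorticity `(t, x) ↦ curl u(t, x)` on the open interior (`curl v x = curlCLM (Dv x)`). -/
theorem continuousOn_curl_velocity
    (hsol : IsClassicalNSSolutionOnRegion (Ico (-1 : ℝ) 0 ×ˢ ball (0 : EuclideanSpace ℝ (Fin 3)) 1) 1 0 u p) :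
    ContinuousOn (fun z : ℝ × EuclideanSpace ℝ (Fin 3) => curl (u z.1) z.2)
      (Ioo (-1 : ℝ) 0 ×ˢ ball (0 : EuclideanSpace ℝ (Fin 3)) 1) := by
  have h := (curlCLM).continuous.comp_continuousOn (continuousOn_fderiv_velocity hsol)
  refine h.congr fun z _ => ?_
  simp only [Function.comp, curl_eq_curlCLM]

/-- on the open interior, `D(curl u(t, ·))(x) = curlCLM ∘ D(∇u(t,·))(x)`. -/
theorem fderiv_curl_velocity_eq
    (hsol : IsClassicalNSSolutionOnRegion (Ico (-1 : ℝ) 0 ×ˢ ball (0 : EuclideanSpace ℝ (Fin 3)) 1) 1 0 u p)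
    {t : ℝ} {x : EuclideanSpace ℝ (Fin 3)} (hz : (t, x) ∈ Ioo (-1 : ℝ) 0 ×ˢ ball (0 : EuclideanSpace ℝ (Fin 3)) 1) :
    fderiv ℝ (curl (u t)) x = (curlCLM).comp (fderiv ℝ (fun x => fderiv ℝ (u t) x) x) := by
  have hd : DifferentiableAt ℝ (fun x => fderiv ℝ (u t) x) x :=
    differentiableAt_slice_of_contDiffOn_region (w := fun t x => fderiv ℝ (u t) x) isOpen_regionS29
      (contDiffOn_fderiv_slice_of_isOpen_region isOpen_regionS29 (smooth_velocity_interior hsol)) hz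
  rw [curl_eq_curlCLM_comp]
  exact ((curlCLM).hasFDerivAt.comp x hd.hasFDerivAt).fderiv

/-- joint continuity of the vorticity gradient `(t, x) ↦ D(curl u(t, ·))(x)` on the open interior. -/
theorem continuousOn_fderiv_curl_velocity
    (hsol : IsClassicalNSSolutionOnRegion (Ico (-1 : ℝ) 0 ×ˢ ball (0 : EuclideanSpace ℝ (Fin 3)) 1) 1 0 u p) :
    ContinuousOn (fun z : ℝ × EuclideanSpace ℝ (Fin 3) => fderiv ℝ (curl (u z.1)) z.2)
      (Ioo (-1 : ℝ) 0 ×ˢ ball (0 : EuclideanSpace ℝ (Fin 3)) 1) := by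
  have h : ContinuousOn (fun z : ℝ × EuclideanSpace ℝ (Fin 3) =>
      (curlCLM).comp (fderiv ℝ (fun x => fderiv ℝ (u z.1) x) z.2))
      (Ioo (-1 : ℝ) 0 ×ˢ ball (0 : EuclideanSpace ℝ (Fin 3)) 1) :=
    continuousOn_const.clm_comp (continuousOn_fderiv_fderiv_velocity hsol)
  exact h.congr fun z hz => fderiv_curl_velocity_eq hsol hz

/-- pointwise: `|ω(t,x)| ≤ 4‖∇u(t,x)‖`. -/
theorem norm_curl_velocity_le (t : ℝ) (x : EuclideanSpace ℝ (Fin 3)) :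
    ‖curl (u t) x‖ ≤ 4 * ‖fderiv ℝ (u t) x‖ :=
  norm_curl_le_four_mul (u t) x

/-- pointwise on the open interior: `‖∇ω(t,x)‖ ≤ 4‖D²u(t,x)‖`. -/
theorem norm_fderiv_curl_velocity_le
    (hsol : IsClassicalNSSolutionOnRegion (Ico (-1 : ℝ) 0 ×ˢ ball (0 : EuclideanSpace ℝ (Fin 3)) 1) 1 0 u p)
    {t : ℝ} {x : EuclideanSpace ℝ (Fin 3)} (ht : t ∈ Ico (-1 : ℝ) 0) (hx : x ∈ ball (0 : EuclideanSpace ℝ (Fin 3)) 1) :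
    ‖fderiv ℝ (curl (u t)) x‖ ≤ 4 * ‖iteratedFDeriv ℝ 2 (u t) x‖ := by
  have h3 : ContDiffOn ℝ 3 (u t) (ball (0 : EuclideanSpace ℝ (Fin 3)) 1) :=
    (contDiffOn_velocity_slice hsol ht).of_le (by norm_cast)
  exact (norm_fderiv_curl_le_of_contDiffOn h3 isOpen_ball hx).trans
    (mul_le_mul_of_nonneg_right norm_curlCLM_le_four (norm_nonneg _))

end Solution
/-! ## §1 Scalar bookkeeping at the slice -/

/-- `ℓ = √(−t̄)` and the lateness: `ℓ² = −t̄`, `0 < ℓ`, `ℓ² < 1/2`, and `2(|y₀|+3R+r_T+4)·ℓ < min c₁ 1`. -/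
theorem slice_scales {c₁ d R rT tb : ℝ} (hc₁ : 0 < c₁) (hd : 0 ≤ d) (hR : 2 ≤ R) (hrT : 0 ≤ rT)
    (htb : tb ∈ Ioo (-(t1S29pkg c₁ d R rT)) 0) :
    0 < Real.sqrt (-tb) ∧ Real.sqrt (-tb) ^ 2 = -tb ∧ -tb < 1 / 2 ∧
      2 * (d + 3 * R + rT + 4) * Real.sqrt (-tb) < min c₁ 1 := by
  have hntb : 0 < -tb := by linarith [htb.2]
  have hℓ : 0 < Real.sqrt (-tb) := Real.sqrt_pos.2 hntb
  have hℓ2 : Real.sqrt (-tb) ^ 2 = -tb := Real.sq_sqrt hntb.le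
  have hT : -tb < t1S29pkg c₁ d R rT := by linarith [htb.1]
  have hhalf : -tb < 1 / 2 := hT.trans_le (min_le_left _ _)
  have hD : 0 < d + 3 * R + rT + 4 := by linarith
  have hm : 0 < min c₁ 1 := lt_min hc₁ one_pos
  have hsq : (2 * (d + 3 * R + rT + 4) * Real.sqrt (-tb)) ^ 2 < (min c₁ 1) ^ 2 := by
    have h1 : -tb < (min c₁ 1) ^ 2 / (4 * (d + 3 * R + rT + 4) ^ 2) := hT.trans_le (min_le_right _ _)
    rw [lt_div_iff₀ (by positivity)] at h1
    calc (2 * (d + 3 * R + rT + 4) * Real.sqrt (-tb)) ^ 2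
        = (-tb) * (4 * (d + 3 * R + rT + 4) ^ 2) := by rw [mul_pow, hℓ2]; ring
      _ < (min c₁ 1) ^ 2 := h1
  exact ⟨hℓ, hℓ2, hhalf, lt_of_pow_lt_pow_left₀ 2 hm.le hsq⟩
/-! ## §2 Stub D -/

/-- **Stub D** `CylinderPackageS29` holds: the Carleman cylinder of height `T_c(−t̄)`, radius `r_T√(−t̄)` centred at
`√(−t̄)·y₀` fits inside the gradient region, inside `B(0, ½)` and inside `(−1, 0)` at every slice `t̄ ∈ (−T₁, 0)`,
`T₁ = t1S29pkg c₁ |y₀| R r_T`, with the (5.5) bounds, the vorticity sup bounds, the peephole bound, the core geometry and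
the continuity the generic stubs B1/B2/B4 consume. -/
theorem cylinderPackageS29_holds : CylinderPackageS29 := by
  intro Cu R K K₂ y₀ rp c₁ rT ε hCu hR hK hK₂ hrp hc₁ hrT hε u p hsol h115 hg1 hg2 tb htb hpeep
  -- scalar bookkeeping; `ℓ`, `x₀`, `T_c`, `τ` made opaque (term-mode `.comp` against `uncurry` types is avoided below: slow unifier)
  have hd0 : 0 ≤ ‖y₀‖ := norm_nonneg _
  have hrT0 : 0 ≤ rT := by linarith
  obtain ⟨hℓ, hℓ2, hhalf, hfit⟩ := slice_scales hc₁ hd0 hR hrT0 htb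
  have htb0 : tb < 0 := htb.2
  have hntb : 0 < -tb := by linarith
  have hTc : 0 < tcS29 Cu K := tcS29_pos hCu hK
  have hTc1 : tcS29 Cu K ≤ 1 := tcS29_le_one Cu K
  have hTcK : tcS29 Cu K ≤ 1 / K := (min_le_right _ _).trans (min_le_left _ _)
  have hTcC : tcS29 Cu K ≤ 1 / Cu ^ 2 := (min_le_right _ _).trans (min_le_right _ _)
  have hKTc : K * tcS29 Cu K ≤ 1 := by rwa [le_div_iff₀ hK, mul_comm] at hTcK
  have hCTc : Cu ^ 2 * tcS29 Cu K ≤ 1 := by rwa [le_div_iff₀ (by positivity), mul_comm] at hTcC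
  have hτ : 0 < tauS29 Cu K := by unfold tauS29; positivity
  have hτTc : 8000 * tauS29 Cu K = tcS29 Cu K := by unfold tauS29; ring
  have hsqTc : Real.sqrt (tcS29 Cu K * (-tb)) = Real.sqrt (tcS29 Cu K) * Real.sqrt (-tb) := Real.sqrt_mul hTc.le _
  have hx₀ : ‖Real.sqrt (-tb) • y₀‖ = Real.sqrt (-tb) * ‖y₀‖ := by rw [norm_smul, Real.norm_of_nonneg hℓ.le]
  generalize hℓg : Real.sqrt (-tb) = ℓ at hℓ hℓ2 hfit hpeep hsqTc hx₀ ⊢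
  generalize hx₀g : ℓ • y₀ = x₀ at hpeep hx₀ ⊢
  generalize hTcg : tcS29 Cu K = Tc at hTc hTc1 hKTc hCTc hτTc hsqTc ⊢
  generalize hτg : tauS29 Cu K = τ at hτ hτTc ⊢
  have hm1 : min c₁ 1 ≤ 1 := min_le_right _ _
  have hmc : min c₁ 1 ≤ c₁ := min_le_left _ _
  have hm0 : 0 < min c₁ 1 := lt_min hc₁ one_pos
  -- `ℓ`-multiples that fit (`D' = |y₀| + 3R + r_T + 4 ≥ 9R + 6`, `2 D' ℓ < min c₁ 1`)
  have hDlow : 9 * R + 6 ≤ ‖y₀‖ + 3 * R + rT + 4 := by linarith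
  have hP1 : ℓ * (‖y₀‖ + rT + 2) ≤ ℓ * (‖y₀‖ + 3 * R + rT + 4) := mul_le_mul_of_nonneg_left (by linarith) hℓ.le
  have hP2 : ℓ * (9 * R + 6) ≤ ℓ * (‖y₀‖ + 3 * R + rT + 4) := mul_le_mul_of_nonneg_left hDlow hℓ.le
  have hfit1 : ℓ * (‖y₀‖ + rT + 1) < 1 / 2 := by linarith
  have hfit2 : ℓ * (‖y₀‖ + rT + 2) < c₁ := by linarith
  have hfit3 : 4 * R * ℓ < 1 / 2 := by linarith
  have hTtb : Tc * (-tb) ≤ -tb := mul_le_of_le_one_left hntb.le hTc1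
  have hTp : 0 < Tc * (-tb) := mul_pos hTc hntb
  have h2τ : 2 * (τ * (-tb)) ≤ -tb := by nlinarith
  -- (i) the slab stays inside `(−1, 0)`
  have h_i : -1 < tb - Tc * (-tb) := by linarith
  -- time points of the slab are in `(−1, 0)` with `ℓ ≤ √(−t) ≤ 2ℓ`
  have hslab : ∀ t ∈ Icc (tb - Tc * (-tb)) tb, t ∈ Ioo (-1 : ℝ) 0 ∧ ℓ ≤ Real.sqrt (-t) ∧ Real.sqrt (-t) ≤ 2 * ℓ := by
    intro t ht
    have h1 : ℓ ^ 2 ≤ -t := by rw [hℓ2]; linarith [ht.2]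
    have h2 : -t ≤ (2 * ℓ) ^ 2 := by rw [mul_pow, hℓ2]; linarith [ht.1]
    refine ⟨⟨by linarith [ht.1], by linarith [ht.2]⟩, ?_, ?_⟩
    · calc ℓ = Real.sqrt (ℓ ^ 2) := (Real.sqrt_sq hℓ.le).symm
        _ ≤ Real.sqrt (-t) := Real.sqrt_le_sqrt h1
    · calc Real.sqrt (-t) ≤ Real.sqrt ((2 * ℓ) ^ 2) := Real.sqrt_le_sqrt h2
        _ = 2 * ℓ := Real.sqrt_sq (by positivity)
  -- (ii) the fattened Carleman ball sits in `B(0, ½)`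
  have h_ii : closedBall x₀ (rT * ℓ + ℓ) ⊆ ball (0 : EuclideanSpace ℝ (Fin 3)) (1 / 2) := by
    intro x hx
    rw [mem_closedBall, dist_eq_norm] at hx
    rw [mem_ball_zero_iff]
    calc ‖x‖ = ‖(x - x₀) + x₀‖ := by rw [sub_add_cancel]
      _ ≤ ‖x - x₀‖ + ‖x₀‖ := norm_add_le _ _
      _ ≤ rT * ℓ + ℓ + ℓ * ‖y₀‖ := by rw [hx₀]; linarith
      _ = ℓ * (‖y₀‖ + rT + 1) := by ring
      _ < 1 / 2 := hfit1
  have hballsub : closedBall x₀ (rT * ℓ) ⊆ ball (0 : EuclideanSpace ℝ (Fin 3)) (1 / 2) :=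
    (closedBall_subset_closedBall (by linarith)).trans h_ii
  have hball1 : ball (0 : EuclideanSpace ℝ (Fin 3)) (1 / 2) ⊆ ball (0 : EuclideanSpace ℝ (Fin 3)) 1 :=
    ball_subset_ball (by norm_num)
  -- points of the Carleman ball: norm bound
  have hxnorm : ∀ x ∈ closedBall x₀ (rT * ℓ), ‖x‖ ≤ ℓ * (‖y₀‖ + rT) := by
    intro x hx
    rw [mem_closedBall, dist_eq_norm] at hx
    calc ‖x‖ = ‖(x - x₀) + x₀‖ := by rw [sub_add_cancel]
      _ ≤ ‖x - x₀‖ + ‖x₀‖ := norm_add_le _ _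
      _ ≤ rT * ℓ + ℓ * ‖y₀‖ := by rw [hx₀]; linarith
      _ = ℓ * (‖y₀‖ + rT) := by ring
  -- the cylinder is inside the gradient region `‖x‖ + √(−t) ≤ c₁`
  have hgrad : ∀ t ∈ Icc (tb - Tc * (-tb)) tb, ∀ x ∈ closedBall x₀ (rT * ℓ), ‖x‖ + Real.sqrt (-t) ≤ c₁ := by
    intro t ht x hx
    obtain ⟨-, -, hs2⟩ := hslab t ht
    have hxn := hxnorm x hx
    linarith
  -- (iii) the (5.5)-type bounds
  have h_iii : ∀ t ∈ Icc (tb - Tc * (-tb)) tb, ∀ x ∈ closedBall x₀ (rT * ℓ),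
      ‖u t x‖ ≤ (Real.sqrt (Tc * (-tb)))⁻¹ ∧ ‖fderiv ℝ (u t) x‖ ≤ (Tc * (-tb))⁻¹ := by
    intro t ht x hx
    obtain ⟨htI, hs1, hs2⟩ := hslab t ht
    have hst : 0 < Real.sqrt (-t) := hℓ.trans_le hs1
    have hxc := hgrad t ht x hx
    have hx1 : x ∈ ball (0 : EuclideanSpace ℝ (Fin 3)) 1 := hball1 (hballsub hx)
    constructor
    · -- velocity: `C_u/(√(−t)+|x|) ≤ C_u/ℓ ≤ (√T_c ℓ)⁻¹`
      have h1 := h115 t ⟨htI.1.le, htI.2⟩ x hx1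
      have h2 : Cu / (Real.sqrt (-t) + ‖x‖) ≤ Cu / ℓ :=
        div_le_div_of_nonneg_left hCu.le hℓ (by linarith [norm_nonneg x])
      have hsTc : 0 < Real.sqrt Tc := Real.sqrt_pos.2 hTc
      have h4 : Cu * Real.sqrt Tc ≤ 1 := by
        have h5 : (Cu * Real.sqrt Tc) ^ 2 ≤ 1 := by rw [mul_pow, Real.sq_sqrt hTc.le]; linarith
        exact (pow_le_one_iff_of_nonneg (by positivity) two_ne_zero).1 h5
      rw [hsqTc]
      calc ‖u t x‖ ≤ Cu / ℓ := h1.trans h2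
        _ = (Cu * Real.sqrt Tc) * (Real.sqrt Tc * ℓ)⁻¹ := by field_simp
        _ ≤ 1 * (Real.sqrt Tc * ℓ)⁻¹ := mul_le_mul_of_nonneg_right h4 (inv_nonneg.2 (by positivity))
        _ = (Real.sqrt Tc * ℓ)⁻¹ := one_mul _
    · -- gradient: `K/(‖x‖+√(−t))² ≤ K/ℓ² = K/(−t̄) ≤ (T_c (−t̄))⁻¹`
      have h1 := hg1 t htI x hxc
      have hden : ℓ ^ 2 ≤ (‖x‖ + Real.sqrt (-t)) ^ 2 := by
        have : ℓ ≤ ‖x‖ + Real.sqrt (-t) := by linarith [norm_nonneg x]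
        exact pow_le_pow_left₀ hℓ.le this 2
      have h2 : K / (‖x‖ + Real.sqrt (-t)) ^ 2 ≤ K / ℓ ^ 2 :=
        div_le_div_of_nonneg_left hK.le (by positivity) hden
      calc ‖fderiv ℝ (u t) x‖ ≤ K / ℓ ^ 2 := h1.trans h2
        _ = (K * Tc) * (Tc * (-tb))⁻¹ := by rw [hℓ2]; field_simp
        _ ≤ 1 * (Tc * (-tb))⁻¹ := mul_le_mul_of_nonneg_right hKTc (inv_nonneg.2 hTp.le)
        _ = (Tc * (-tb))⁻¹ := one_mul _
  -- the affine changes of variables `(s, y) ↦ (t̄ − s, x₀ + y)` and `(s, x) ↦ (t̄ − s, x)`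
  have hA : Continuous fun z : ℝ × EuclideanSpace ℝ (Fin 3) => (tb - z.1, x₀ + z.2) := by fun_prop
  have hA' : Continuous fun z : ℝ × EuclideanSpace ℝ (Fin 3) => (tb - z.1, z.2) := by fun_prop
  have hshift : ∀ y ∈ closedBall (0 : EuclideanSpace ℝ (Fin 3)) (rT * ℓ), x₀ + y ∈ closedBall x₀ (rT * ℓ) := by
    intro y hy
    rw [mem_closedBall, dist_eq_norm, add_sub_cancel_left]
    exact mem_closedBall_zero_iff.1 hy
  have hwin : ∀ s ∈ Icc 0 (Tc * (-tb)), tb - s ∈ Icc (tb - Tc * (-tb)) tb :=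
    fun s hs => ⟨by linarith [hs.2], by linarith [hs.1]⟩
  have hmaps : MapsTo (fun z : ℝ × EuclideanSpace ℝ (Fin 3) => (tb - z.1, x₀ + z.2))
      (Icc 0 (Tc * (-tb)) ×ˢ closedBall (0 : EuclideanSpace ℝ (Fin 3)) (rT * ℓ))
      (Ioo (-1 : ℝ) 0 ×ˢ ball (0 : EuclideanSpace ℝ (Fin 3)) 1) := by
    rintro ⟨s, y⟩ ⟨hs, hy⟩
    exact ⟨(hslab _ (hwin s hs)).1, hball1 (hballsub (hshift y hy))⟩
  -- (iv) continuity of the backward translated vorticity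
  have h_iv : ContinuousOn (uncurry fun s y => curl (u (tb - s)) (x₀ + y))
      (Icc 0 (Tc * (-tb)) ×ˢ closedBall (0 : EuclideanSpace ℝ (Fin 3)) (rT * ℓ)) := by
    have h := (continuousOn_curl_velocity hsol).comp hA.continuousOn hmaps
    exact h
  -- (v) continuity of its gradient
  have h_v : ContinuousOn (fun z : ℝ × EuclideanSpace ℝ (Fin 3) =>
      fderiv ℝ (fun y => curl (u (tb - z.1)) (x₀ + y)) z.2)
      (Icc 0 (Tc * (-tb)) ×ˢ closedBall (0 : EuclideanSpace ℝ (Fin 3)) (rT * ℓ)) := by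
    have h := (continuousOn_fderiv_curl_velocity hsol).comp hA.continuousOn hmaps
    refine h.congr fun z _ => ?_
    simp only [Function.comp]
    exact fderiv_comp_add_left x₀
  -- (vi) sup bounds on the cylinder
  have hℓ3 : ℓ ^ 3 = (-tb) * ℓ := by rw [← hℓ2]; ring
  have h_vi : ∀ s ∈ Icc 0 (Tc * (-tb)), ∀ y ∈ closedBall (0 : EuclideanSpace ℝ (Fin 3)) (rT * ℓ),
      ‖curl (u (tb - s)) (x₀ + y)‖ ≤ 6 * K / (-tb) ∧
      ‖fderiv ℝ (fun y => curl (u (tb - s)) (x₀ + y)) y‖ ≤ 6 * K₂ / ((-tb) * ℓ) := by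
    intro s hs y hy
    have ht := hwin s hs
    have hx := hshift y hy
    obtain ⟨htI, hs1, hs2⟩ := hslab _ ht
    have hxc := hgrad _ ht _ hx
    have hx1 : x₀ + y ∈ ball (0 : EuclideanSpace ℝ (Fin 3)) 1 := hball1 (hballsub hx)
    have hsum : ℓ ≤ ‖x₀ + y‖ + Real.sqrt (-(tb - s)) := by linarith [norm_nonneg (x₀ + y)]
    have hKq : 0 ≤ K / (-tb) := div_nonneg hK.le hntb.le
    have hK₂q : 0 ≤ K₂ / ((-tb) * ℓ) := div_nonneg hK₂.le (by positivity)
    constructor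
    · have h1 := hg1 _ htI _ hxc
      have h2 : K / (‖x₀ + y‖ + Real.sqrt (-(tb - s))) ^ 2 ≤ K / ℓ ^ 2 :=
        div_le_div_of_nonneg_left hK.le (by positivity) (pow_le_pow_left₀ hℓ.le hsum 2)
      rw [hℓ2] at h2
      calc ‖curl (u (tb - s)) (x₀ + y)‖ ≤ 4 * ‖fderiv ℝ (u (tb - s)) (x₀ + y)‖ := norm_curl_velocity_le _ _
        _ ≤ 4 * (K / (-tb)) := by linarith [h1.trans h2]
        _ ≤ 6 * K / (-tb) := by rw [mul_div_assoc]; linarith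
    · have h1 := hg2 _ htI _ hxc
      have h2 : K₂ / (‖x₀ + y‖ + Real.sqrt (-(tb - s))) ^ 3 ≤ K₂ / ℓ ^ 3 :=
        div_le_div_of_nonneg_left hK₂.le (by positivity) (pow_le_pow_left₀ hℓ.le hsum 3)
      rw [hℓ3] at h2
      rw [fderiv_comp_add_left x₀]
      calc ‖fderiv ℝ (curl (u (tb - s))) (x₀ + y)‖ ≤ 4 * ‖iteratedFDeriv ℝ 2 (u (tb - s)) (x₀ + y)‖ :=
            norm_fderiv_curl_velocity_le hsol ⟨htI.1.le, htI.2⟩ hx1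
        _ ≤ 4 * (K₂ / ((-tb) * ℓ)) := by linarith [h1.trans h2]
        _ ≤ 6 * K₂ / ((-tb) * ℓ) := by rw [mul_div_assoc]; linarith
  -- (vii) the peephole bound restated for `U 0`
  have h_vii : ∀ y ∈ ball (0 : EuclideanSpace ℝ (Fin 3)) (rp * ℓ), ‖curl (u (tb - 0)) (x₀ + y)‖ ≤ ε / (-tb) := by
    intro y hy
    have hx : x₀ + y ∈ ball x₀ (ℓ * rp) := by
      rw [mem_ball, dist_eq_norm, add_sub_cancel_left, mul_comm]
      exact mem_ball_zero_iff.1 hy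
    have h := hpeep (x₀ + y) hx
    rw [sub_zero, le_div_iff₀ hntb, mul_comm]
    exact h
  -- (viii) the core ball sits inside the half Carleman ball
  have hcore : ℓ * (2 * (‖y₀‖ + 3 * R) + 2) ≤ ℓ * rT := mul_le_mul_of_nonneg_left hrT hℓ.le
  have h_viii : ball (0 : EuclideanSpace ℝ (Fin 3)) (3 * R * ℓ) ⊆ ball x₀ ((rT * ℓ) / 2) := by
    intro x hx
    rw [mem_ball_zero_iff] at hx
    rw [mem_ball, dist_eq_norm]
    calc ‖x - x₀‖ ≤ ‖x‖ + ‖x₀‖ := norm_sub_le _ _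
      _ < 3 * R * ℓ + ℓ * ‖y₀‖ := by rw [hx₀]; linarith
      _ ≤ (rT * ℓ) / 2 := by linarith
  -- (ix) the Gaussian weight exponent on the core during the window
  have h_ix : ∀ s ∈ Icc (τ * (-tb)) (2 * (τ * (-tb))), ∀ x ∈ ball (0 : EuclideanSpace ℝ (Fin 3)) (3 * R * ℓ),
      ‖x - x₀‖ ^ 2 / (4 * s) ≤ (‖y₀‖ + 3 * R) ^ 2 / (4 * τ) := by
    intro s hs x hx
    rw [mem_ball_zero_iff] at hx
    have hτtb : 0 < τ * (-tb) := mul_pos hτ hntb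
    have hs0 : 0 < s := lt_of_lt_of_le hτtb hs.1
    have hnum : ‖x - x₀‖ ≤ ℓ * (‖y₀‖ + 3 * R) := by
      calc ‖x - x₀‖ ≤ ‖x‖ + ‖x₀‖ := norm_sub_le _ _
        _ ≤ 3 * R * ℓ + ℓ * ‖y₀‖ := by rw [hx₀]; linarith
        _ = ℓ * (‖y₀‖ + 3 * R) := by ring
    have hnum2 : ‖x - x₀‖ ^ 2 ≤ (ℓ * (‖y₀‖ + 3 * R)) ^ 2 := pow_le_pow_left₀ (norm_nonneg _) hnum 2
    have h4s : 4 * (τ * (-tb)) ≤ 4 * s := by linarith [hs.1]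
    calc ‖x - x₀‖ ^ 2 / (4 * s) ≤ (ℓ * (‖y₀‖ + 3 * R)) ^ 2 / (4 * (τ * (-tb))) :=
          div_le_div₀ (by positivity) hnum2 (by positivity) h4s
      _ = (‖y₀‖ + 3 * R) ^ 2 / (4 * τ) := by
          rw [mul_pow, hℓ2, show 4 * (τ * (-tb)) = (-tb) * (4 * τ) by ring, mul_div_mul_left _ _ hntb.ne']
  -- (x) continuity of the backward vorticity on the (untranslated) window cylinder
  have hmaps' : MapsTo (fun z : ℝ × EuclideanSpace ℝ (Fin 3) => (tb - z.1, z.2))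
      (Icc (τ * (-tb)) (2 * (τ * (-tb))) ×ˢ closedBall (0 : EuclideanSpace ℝ (Fin 3)) (4 * R * ℓ))
      (Ioo (-1 : ℝ) 0 ×ˢ ball (0 : EuclideanSpace ℝ (Fin 3)) 1) := by
    rintro ⟨s, x⟩ ⟨hs, hx⟩
    have hτtb : 0 < τ * (-tb) := mul_pos hτ hntb
    refine ⟨⟨by linarith [hs.2], by linarith [hs.1]⟩, ?_⟩
    rw [mem_ball_zero_iff]
    have := mem_closedBall_zero_iff.1 hx
    linarith
  have h_x : ContinuousOn (uncurry fun s x => curl (u (tb - s)) x)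
      (Icc (τ * (-tb)) (2 * (τ * (-tb))) ×ˢ closedBall (0 : EuclideanSpace ℝ (Fin 3)) (4 * R * ℓ)) := by
    have h := (continuousOn_curl_velocity hsol).comp hA'.continuousOn hmaps'
    exact h
  exact ⟨h_i, h_ii, h_iii, h_iv, h_v, h_vi, h_vii, h_viii, h_ix, h_x⟩

end Summit.NavierStokesRegularity.NavierStokesRegularity.Theorems.PeepholeVorticityDoor

end
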